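import Summits.ValiantsHypothesis.ValiantsHypothesis.Theses.GrenetZeon

/-!
# Skeleton line `subs-split` for the deciding crux `AlgDcQP` (stmt-ValiantsHypothesis-8060):
# the BC2-redirect decomposition `AlgDcQP ⇐ TransferToDc ∧ AbelianizationQP ∧ PolySizeQPAlgebra`

The three registered stubs ARE the route's items `TransferToDc` (stmt-8069, support — a theorem of
the model: Mahajan–Vinay over `R` + regular representation; line `transfer-mv-unroll`),
`AbelianizationQP` (stmt-8063, crux; line `zeon-window`) and `PolySizeQPAlgebra` (stmt-8064, crux;
line `vbp-slice-dealg`), stated BY NAME so that `…_holds` theorems discharge them; the composition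
`AlgDcQP_of` is the kernel-checked assembly (ℕ bookkeeping: quasi-polynomial of quasi-polynomial is
quasi-polynomial), identical to `Cruxes/AlgDcQP/AlgDcQPSplit.lean` = the drop-in Theorems file
`GrenetZeonAlgDcQPSplit.lean` (planners cannot land Theorems; attached as evidence on stmt-8060).

Per-piece probes (BC2(c), folder bc/*_probe*.lean): `piece → ValiantsHypothesis`,
`piece → AlgDcQP`, `ValiantsHypothesis → piece`, `AlgDcQP → piece` all FAIL for all three pieces
(exact? / simpa / unfold+simpa / aesop: unsolved goals or heartbeat timeout).  Mathematically:
`AlgDcQP → PolySizeQPAlgebra` holds (weakening: poly ≤ qp matrix size) — a consequence used toward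
X; no piece implies X or S: `PolySizeQPAlgebra` is `VNP ⊄ VBP`-level on its `s = 1` slice,
`AbelianizationQP` is consistent with `per ∈ VP`, `TransferToDc` is true.
-/

noncomputable section

set_option linter.dupNamespace false

namespace Summit.ValiantsHypothesis.ValiantsHypothesis.Cruxes.AlgDcQP.SubsSplit

open Literature.Computability.AlgebraicComplexity
open Summit.ValiantsHypothesis.ValiantsHypothesis.Theses.GrenetZeon

/-! ### The three pieces (registered stubs = route items, by name) -/

/-- **Stub 1 = item `TransferToDc` (stmt-ValiantsHypothesis-8069, support; TRUE — line
`transfer-mv-unroll`):** an `(m, s)`-representation of `per_n` gives `dc(per_n) ≤ (s+1)(m+1)^3`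
(Mahajan–Vinay 1997; Ikenmeyer–Landsberg 2017 Thm. 4.1; Hrubeš–Yehudayoff 2011 Thm. 4.2). Size: L. -/
theorem stub_transferToDc : TransferToDc := by
  sorry

/-- **Stub 2 = item `AbelianizationQP` (stmt-ValiantsHypothesis-8063, crux; line `zeon-window`):**
`∃ c`, every size-`m` affine determinantal representation of `per_n` yields an
`(n^c + c, 2^((log₂ m + c)^c))`-representation (Grenet 2011 ↦ zeons, Landsberg–Ressayre 2017 ↦
apolar algebra are the known instances). Size: open-problem. -/
theorem stub_abelianizationQP : AbelianizationQP := by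
  sorry

/-- **Stub 3 = item `PolySizeQPAlgebra` (stmt-ValiantsHypothesis-8064, crux; line
`vbp-slice-dealg`):** for every `c`, for all large `n`, no `(m, s)`-representation of `per_n` with
`m ≤ n^c + c`, `s ≤ 2^((log₂ n + c)^c)` (its `s = 1` slice is `VNP ⊄ VBP`; Bürgisser 2000 Ch. 2).
Size: open-problem. -/
theorem stub_polySizeQPAlgebra : PolySizeQPAlgebra := by
  sorry

/-! ### ℕ bookkeeping: quasi-polynomial of quasi-polynomial is quasi-polynomial -/

/-- `(L + c)^c ≥ 1` (for `c = 0` it is `1`, otherwise the base is positive). -/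
theorem one_le_pow_add (L c : ℕ) : 1 ≤ (L + c) ^ c := by
  rcases Nat.eq_zero_or_pos c with rfl | hc
  · simp
  · exact Nat.one_le_pow _ _ (by omega)

/-- First absorption step: `4 (L+c)^c + 4 + a ≤ (L + c + a + 8)^(c+1)`. -/
theorem step_base (L c a : ℕ) : 4 * (L + c) ^ c + 4 + a ≤ (L + c + a + 8) ^ (c + 1) := by
  have h1 : 1 ≤ (L + c) ^ c := one_le_pow_add L c
  have h2 : (L + c) ^ c ≤ (L + c + a + 8) ^ c := Nat.pow_le_pow_left (by omega) c
  have h3 : 4 + a ≤ (L + c + a + 4) * (L + c) ^ c :=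
    calc 4 + a = (a + 4) * 1 := by ring
      _ ≤ (a + 4) * (L + c) ^ c := Nat.mul_le_mul_left _ h1
      _ ≤ (L + c + a + 4) * (L + c) ^ c := Nat.mul_le_mul_right _ (by omega)
  calc 4 * (L + c) ^ c + 4 + a
      = 4 * (L + c) ^ c + (4 + a) := by ring
    _ ≤ 4 * (L + c) ^ c + (L + c + a + 4) * (L + c) ^ c := Nat.add_le_add_left h3 _
    _ = (L + c + a + 8) * (L + c) ^ c := by ring
    _ ≤ (L + c + a + 8) * (L + c + a + 8) ^ c := Nat.mul_le_mul_left _ h2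
    _ = (L + c + a + 8) ^ (c + 1) := by ring

/-- Second absorption step: `(4 (L+c)^c + 4 + a)^a ≤ (L + C)^C` with `C = (c + a + 8)(a + 1)`. -/
theorem step_pow (L c a : ℕ) :
    (4 * (L + c) ^ c + 4 + a) ^ a ≤ (L + (c + a + 8) * (a + 1)) ^ ((c + a + 8) * (a + 1)) := by
  have hC1 : c + a + 8 ≤ (c + a + 8) * (a + 1) := Nat.le_mul_of_pos_right _ (by omega)
  have hC2 : (c + 1) * a ≤ (c + a + 8) * (a + 1) := Nat.mul_le_mul (by omega) (by omega)
  calc (4 * (L + c) ^ c + 4 + a) ^ a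
      ≤ ((L + c + a + 8) ^ (c + 1)) ^ a := Nat.pow_le_pow_left (step_base L c a) a
    _ = (L + c + a + 8) ^ ((c + 1) * a) := by rw [← pow_mul]
    _ ≤ (L + (c + a + 8) * (a + 1)) ^ ((c + 1) * a) := Nat.pow_le_pow_left (by omega) _
    _ ≤ (L + (c + a + 8) * (a + 1)) ^ ((c + a + 8) * (a + 1)) :=
        Nat.pow_le_pow_right (by omega) hC2

/-- The transfer size `M = (s+1)(m+1)^3` of a representation inside the box `m, s ≤ 2^((L+c)^c)`
has `log₂ M ≤ 4 (L+c)^c + 4`. -/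
theorem log_transfer_le (L c m s : ℕ) (hm : m ≤ 2 ^ ((L + c) ^ c)) (hs : s ≤ 2 ^ ((L + c) ^ c)) :
    Nat.log 2 ((s + 1) * (m + 1) ^ 3) ≤ 4 * (L + c) ^ c + 4 := by
  set Q := (L + c) ^ c with hQ
  have hQ1 : 1 ≤ 2 ^ Q := Nat.one_le_two_pow
  have hm' : m + 1 ≤ 2 ^ (Q + 1) := by rw [pow_succ]; omega
  have hs' : s + 1 ≤ 2 ^ (Q + 1) := by rw [pow_succ]; omega
  have h1 : (s + 1) * (m + 1) ^ 3 ≤ 2 ^ (4 * Q + 4) :=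
    calc (s + 1) * (m + 1) ^ 3 ≤ 2 ^ (Q + 1) * (2 ^ (Q + 1)) ^ 3 :=
          Nat.mul_le_mul hs' (Nat.pow_le_pow_left hm' 3)
      _ = 2 ^ (4 * Q + 4) := by ring
  calc Nat.log 2 ((s + 1) * (m + 1) ^ 3) ≤ Nat.log 2 (2 ^ (4 * Q + 4)) := Nat.log_mono_right h1
    _ = 4 * Q + 4 := Nat.log_pow (by norm_num) _

/-! ### The decomposition -/

/-- **`AlgDcQP` from its three pieces** (route `GrenetZeon`, BC2 redirect of the deciding crux):
`TransferToDc → AbelianizationQP → PolySizeQPAlgebra → AlgDcQP`.  Given `c`, let `a` be the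
abelianization constant and `C := (c + a + 8)(a + 1)`; take `n₀` from `PolySizeQPAlgebra` at `C`
(and `n ≥ 1`).  An `(m, s)`-representation with `m, s ≤ 2^((log₂ n + c)^c)` transfers to an affine
determinantal representation of size `M = (s+1)(m+1)^3`, abelianizes to an
`(n^a + a, 2^((log₂ M + a)^a))`-representation, and `n^a + a ≤ n^C + C`,
`(log₂ M + a)^a ≤ (log₂ n + C)^C` put it inside the box that `PolySizeQPAlgebra` excludes. -/
theorem AlgDcQP_of_subs (hT : TransferToDc) (hA : AbelianizationQP) (hP : PolySizeQPAlgebra) :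
    AlgDcQP := by
  obtain ⟨a, ha⟩ := hA
  intro c
  obtain ⟨n₀, hn₀⟩ := hP ((c + a + 8) * (a + 1))
  refine ⟨max n₀ 1, fun n hn m s hm hs hrep => ?_⟩
  have hn₀n : n₀ ≤ n := le_of_max_le_left hn
  have h1n : 1 ≤ n := le_of_max_le_right hn
  have hCa : a ≤ (c + a + 8) * (a + 1) :=
    calc a ≤ (c + a + 8) * 1 := by omega
      _ ≤ (c + a + 8) * (a + 1) := Nat.mul_le_mul_left _ (by omega)
  -- transfer to ordinary determinantal complexity
  have hdc : HasDetRepr (perPoly (Fin n) ℂ) ((s + 1) * (m + 1) ^ 3) := hT n m s hrep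
  -- abelianize at quasi-polynomial cost
  have hrep' := ha n ((s + 1) * (m + 1) ^ 3) h1n hdc
  -- the polynomial-size exclusion at constant `C` forbids the result
  refine hn₀ n hn₀n (n ^ a + a) (2 ^ ((Nat.log 2 ((s + 1) * (m + 1) ^ 3) + a) ^ a)) ?_ ?_ hrep'
  · exact Nat.add_le_add (Nat.pow_le_pow_right h1n hCa) hCa
  · exact Nat.pow_le_pow_right (by norm_num)
      ((Nat.pow_le_pow_left (Nat.add_le_add_right (log_transfer_le _ c m s hm hs) a) a).trans
        (step_pow _ c a))


/-- **The crux from its pieces (registered composition).** -/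
theorem AlgDcQP_of : AlgDcQP :=
  AlgDcQP_of_subs stub_transferToDc stub_abelianizationQP stub_polySizeQPAlgebra

end Summit.ValiantsHypothesis.ValiantsHypothesis.Cruxes.AlgDcQP.SubsSplit
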